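import Summits.RiemannHypothesis.RiemannHypothesis.Theorems.WindowStep.Negative.DefectTools
import Literature.NumberTheory.LFunctions.WeilRescalingVariation
import Literature.NumberTheory.LFunctions.WeilDilationVirial
import Literature.NumberTheory.LFunctions.WeilMellinBounds
import HarnessLib

/-!
# `WindowStep`, line `conjugate-point` — stub `stub_traceDilate`

Support file for the crux `stmt-RiemannHypothesis-14659`
(`Summit.RiemannHypothesis.RiemannHypothesis.Theses.SpectralTrace.WindowStep`), line
`conjugate-point`: a real family `γ` reproducing the Weil functional `W` on the Weil tests
supported in EVERY smaller closed window `[-B, B]`, `0 < B < A`, reproduces it on the Weil tests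
supported in the CLOSED window `[-A, A]` (closedness of the set of trace levels of one family).

Proof (dilation, RH-free). Fix a Weil test `g` with `tsupport g ⊆ [-A, A]`. For `c > 1` the
rescaling `g_c(t) = g(c t)` is a Weil test supported in `[-A/c, A/c]`, `A/c < A`
(`IsWeilTest.comp_mul`, `tsupport_comp_mul_subset`), so `Σ_i ĝ_c(1/2 + iγ_i) = W(g_c)`.
Let `c → 1⁺`:
* `W(g_c) → W(g)` by the differentiability of `c ↦ W(g_c)` (`hasDerivAt_weilFunctional_comp_mul`);
* `Σ_i ĝ_c(1/2 + iγ_i) → Σ_i ĝ(1/2 + iγ_i)` by Tannery's theorem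
  (`tendsto_tsum_of_dominated_convergence`): termwise by `hasDerivAt_weilMellin_comp_mul`, and
  dominated for `c ∈ (1, 2)` — via `ĝ_c(s) = c⁻¹ ĝ(1/2 + (s - 1/2)/c)` (`weilMellin_comp_mul`) and
  the quadratic decay `‖ĝ(1/2 + iu)‖ ≤ (C_g + C_{g''})/(1 + u²)²` (`norm_weilMellin_line_le_sq`) — by
  `16 (C_g + C_{g''})/(1 + γ_i²)²`, summable over the family by the local Weyl law
  (`card_near_le_log_of_windowTrace` at level `A/2`, integer cells `⌊γ_i⌋ = n`; the pattern of
  `summable_norm_weilMellin_of_windowTrace` in `Theorems/WindowStep/Negative/DefectTools.lean`);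
* the family sum converges absolutely for every Weil test (`summable_weilMellin_of_windowTrace`
  at level `A/2`), and uniqueness of limits along `𝓝[>] 1` identifies it with `W(g)`.
-/

set_option linter.dupNamespace false

noncomputable section

open Complex Set Filter MeasureTheory
open scoped Real Topology

namespace Summit.RiemannHypothesis.RiemannHypothesis.Theorems.SpectralTraceWindowStep

open Literature.NumberTheory.LFunctions
open Summit.RiemannHypothesis.RiemannHypothesis.Theorems.WindowTraceArch.Negative
open Summit.RiemannHypothesis.RiemannHypothesis.Theorems.SpectralThesis.Sketch.ClosedLadder
open Summit.RiemannHypothesis.RiemannHypothesis.Theorems.WindowStep.Negative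

/-- **Summability of `1/(1 + γ_i²)²` over a window-trace family.** For a real family reproducing
`W` on the Weil tests supported in `[-B, B]` (`B > 0`), `Σ_i 1/(1 + γ_i²)² < ∞`: integer cells
`⌊γ_i⌋ = n` carry `≤ C (1 + log(1 + |n|))` indices (`card_near_le_log_of_windowTrace`) and
`1/(1 + γ_i²)² ≤ 16/(1 + n²)²` on the cell. [folklore] -/
theorem summable_one_div_one_add_sq_sq_of_windowTrace {B : ℝ} (hB : 0 < B) {ι : Type*}
    {γ : ι → ℝ}
    (h : ∀ g : ℝ → ℂ, IsWeilTest g → tsupport g ⊆ Icc (-B) B →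
      HasSum (fun i => weilMellin g (1 / 2 + (γ i : ℂ) * I)) (weilFunctional g)) :
    Summable fun i => 1 / (1 + γ i ^ 2) ^ 2 := by
  -- adapted from `summable_norm_weilMellin_of_windowTrace`
  -- (Theorems/WindowStep/Negative/DefectTools.lean)
  obtain ⟨C, hC, hcard⟩ := card_near_le_log_of_windowTrace hB h
  -- integer cells `⌊γ_i⌋ = n`: finite, with `≤ C (1 + log (1 + |n|))` elements
  set cls : ι → ℤ := fun i => ⌊γ i⌋ with hcls
  have hcell : ∀ n : ℤ, Finite {i // cls i = n} ∧
      (Nat.card {i // cls i = n} : ℝ) ≤ C * (1 + Real.log (1 + |(n : ℝ)|)) := by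
    intro n
    refine finite_and_natCard_le fun s hs => hcard n s fun i hi => ?_
    have hfl : ⌊γ i⌋ = n := hs i hi
    have h1 : (n : ℝ) ≤ γ i := by rw [← hfl]; exact Int.floor_le _
    have h2 : γ i < n + 1 := by rw [← hfl]; exact Int.lt_floor_add_one _
    rw [abs_le]
    constructor <;> linarith
  -- the term on a cell
  have hterm : ∀ (n : ℤ) (i : {i // cls i = n}),
      1 / (1 + γ i.1 ^ 2) ^ 2 ≤ 16 * 1 / (1 + (n : ℝ) ^ 2) ^ 2 := by
    intro n i
    have hfl : ⌊γ i.1⌋ = n := i.2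
    have h1 : ((⌊γ i.1⌋ : ℤ) : ℝ) ≤ γ i.1 := Int.floor_le _
    have h2 : γ i.1 < ((⌊γ i.1⌋ : ℤ) : ℝ) + 1 := Int.lt_floor_add_one _
    rw [hfl] at h1 h2
    rw [div_le_div_iff₀ (by positivity) (by positivity), one_mul, mul_one]
    have h0 : (γ i.1 - n) ^ 2 ≤ 1 := by nlinarith
    have hn2 : (n : ℝ) ^ 2 ≤ 2 * γ i.1 ^ 2 + 2 * (γ i.1 - n) ^ 2 := by
      nlinarith [sq_nonneg (γ i.1 + (γ i.1 - n))]
    have h4 : 1 + (n : ℝ) ^ 2 ≤ 4 * (1 + γ i.1 ^ 2) := by nlinarith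
    have h5 : 0 ≤ 1 + (n : ℝ) ^ 2 := by positivity
    nlinarith
  -- regroup along the cells
  set F : ι → ℝ := fun i => 1 / (1 + γ i ^ 2) ^ 2 with hF
  have hF0 : ∀ i, 0 ≤ F i := fun i => by positivity
  suffices hσ : Summable (F ∘ Equiv.sigmaFiberEquiv cls) from
    (Equiv.summable_iff _).1 hσ
  refine (summable_sigma_of_nonneg fun _ => hF0 _).2 ⟨fun n => ?_, ?_⟩
  · haveI := (hcell n).1
    exact Summable.of_finite
  · refine Summable.of_nonneg_of_le (fun n => tsum_nonneg fun _ => hF0 _) (fun n => ?_)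
      (summable_cellBound C 1 zero_le_one)
    haveI := (hcell n).1
    haveI : Fintype {i // cls i = n} := Fintype.ofFinite _
    simp only [Equiv.sigmaFiberEquiv_apply]
    rw [tsum_fintype]
    have hsum : ∑ i : {i // cls i = n}, F i.1 ≤
        (Fintype.card {i // cls i = n} : ℝ) * (16 * 1 / (1 + (n : ℝ) ^ 2) ^ 2) := by
      have := Finset.sum_le_card_nsmul (Finset.univ : Finset {i // cls i = n})
        (fun i => F i.1) (16 * 1 / (1 + (n : ℝ) ^ 2) ^ 2) fun i _ => hterm n i
      rwa [nsmul_eq_mul, Finset.card_univ] at this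
    have hcardn : (Fintype.card {i // cls i = n} : ℝ) ≤ C * (1 + Real.log (1 + |(n : ℝ)|)) := by
      rw [← Nat.card_eq_fintype_card]
      exact (hcell n).2
    have hlog : 1 + Real.log (1 + |(n : ℝ)|) ≤ 2 + |(n : ℝ)| := by
      have := Real.log_le_sub_one_of_pos (by positivity : 0 < 1 + |(n : ℝ)|)
      linarith
    have hb0 : 0 ≤ 16 * 1 / (1 + (n : ℝ) ^ 2) ^ 2 := by positivity
    calc ∑ i : {i // cls i = n}, F i.1
        ≤ (Fintype.card {i // cls i = n} : ℝ) * (16 * 1 / (1 + (n : ℝ) ^ 2) ^ 2) := hsum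
      _ ≤ C * (1 + Real.log (1 + |(n : ℝ)|)) * (16 * 1 / (1 + (n : ℝ) ^ 2) ^ 2) :=
          mul_le_mul_of_nonneg_right hcardn hb0
      _ ≤ C * (2 + |(n : ℝ)|) * (16 * 1 / (1 + (n : ℝ) ^ 2) ^ 2) := by
          apply mul_le_mul_of_nonneg_right _ hb0
          exact mul_le_mul_of_nonneg_left hlog hC.le

/-- **Domination of the dilates on the critical line.** For a Weil test `g`, `1 ≤ c ≤ 2` and a real
height `γ`, `‖(g(c ·))^(1/2 + iγ)‖ = c⁻¹ ‖ĝ(1/2 + iγ/c)‖ ≤ 16 (C_g + C_{g''}) / (1 + γ²)²`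
(`weilMellin_comp_mul`, `norm_weilMellin_line_le_sq`, and `1 + γ² ≤ 4 (1 + (γ/c)²)`).
[folklore] -/
theorem norm_weilMellin_comp_mul_le {g : ℝ → ℂ} (hg : IsWeilTest g) {c : ℝ} (hc1 : 1 ≤ c)
    (hc2 : c ≤ 2) (γ : ℝ) :
    ‖weilMellin (fun t => g (c * t)) (1 / 2 + (γ : ℂ) * I)‖ ≤
      16 * (weilDecayConst g + weilDecayConst (deriv (deriv g))) / (1 + γ ^ 2) ^ 2 := by
  have hc : 0 < c := one_pos.trans_le hc1
  have hD0 : 0 ≤ weilDecayConst g + weilDecayConst (deriv (deriv g)) :=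
    add_nonneg (weilDecayConst_nonneg _) (weilDecayConst_nonneg _)
  set u : ℝ := γ / c with hu
  have hs : (1 / 2 + ((1 / 2 + (γ : ℂ) * I) - 1 / 2) / (c : ℂ) : ℂ) = 1 / 2 + (u : ℂ) * I := by
    rw [hu, Complex.ofReal_div]
    ring
  rw [weilMellin_comp_mul g hc, hs, norm_mul, norm_inv, Complex.norm_real, Real.norm_eq_abs,
    abs_of_pos hc]
  have h1 : ‖weilMellin g (1 / 2 + (u : ℂ) * I)‖ ≤
      (weilDecayConst g + weilDecayConst (deriv (deriv g))) / (1 + u ^ 2) ^ 2 :=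
    norm_weilMellin_line_le_sq hg u
  have hn := norm_nonneg (weilMellin g (1 / 2 + (u : ℂ) * I))
  have hcinv : c⁻¹ ≤ 1 := inv_le_one_of_one_le₀ hc1
  have h2 : c⁻¹ * ‖weilMellin g (1 / 2 + (u : ℂ) * I)‖ ≤
      (weilDecayConst g + weilDecayConst (deriv (deriv g))) / (1 + u ^ 2) ^ 2 := by
    calc c⁻¹ * ‖weilMellin g (1 / 2 + (u : ℂ) * I)‖
        ≤ 1 * ‖weilMellin g (1 / 2 + (u : ℂ) * I)‖ := mul_le_mul_of_nonneg_right hcinv hn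
      _ = ‖weilMellin g (1 / 2 + (u : ℂ) * I)‖ := one_mul _
      _ ≤ _ := h1
  refine h2.trans ?_
  rw [div_le_div_iff₀ (by positivity) (by positivity)]
  have hγ : γ = c * u := by rw [hu]; field_simp
  have hc4 : c ^ 2 ≤ 4 := by nlinarith
  have h4 : 1 + γ ^ 2 ≤ 4 * (1 + u ^ 2) := by
    have := mul_le_mul_of_nonneg_right hc4 (sq_nonneg u)
    rw [hγ, mul_pow]
    linarith
  have h5 : 0 ≤ 1 + γ ^ 2 := by positivity
  calc (weilDecayConst g + weilDecayConst (deriv (deriv g))) * (1 + γ ^ 2) ^ 2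
      ≤ (weilDecayConst g + weilDecayConst (deriv (deriv g))) * (16 * (1 + u ^ 2) ^ 2) := by
        apply mul_le_mul_of_nonneg_left _ hD0
        nlinarith
    _ = 16 * (weilDecayConst g + weilDecayConst (deriv (deriv g))) * (1 + u ^ 2) ^ 2 := by ring

/-- **stub_traceDilate (RH-free).** A real family `γ` reproducing the Weil functional on the Weil
tests supported in every closed window `[-B, B]` with `0 < B < A` reproduces it on the Weil tests
supported in the closed window `[-A, A]`: dilate `g ↦ g(c ·)`, `c → 1⁺`, continuity of
`c ↦ W(g(c ·))` (`hasDerivAt_weilFunctional_comp_mul`), Tannery's theorem over the family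
(domination `norm_weilMellin_comp_mul_le`, summable by
`summable_one_div_one_add_sq_sq_of_windowTrace`), and uniqueness of limits; the family sum is
absolutely convergent on every test (`summable_weilMellin_of_windowTrace`). [folklore] -/
theorem stub_traceDilate :
    ∀ A : ℝ, 0 < A → ∀ (ι : Type) (γ : ι → ℝ),
      (∀ B : ℝ, 0 < B → B < A →
        ∀ g : ℝ → ℂ, Literature.NumberTheory.LFunctions.IsWeilTest g →
          tsupport g ⊆ Set.Icc (-B) B →
            HasSum (fun i => Literature.NumberTheory.LFunctions.weilMellin g (1 / 2 + (γ i : ℂ) * Complex.I))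
              (Literature.NumberTheory.LFunctions.weilFunctional g)) →
      ∀ g : ℝ → ℂ, Literature.NumberTheory.LFunctions.IsWeilTest g →
        tsupport g ⊆ Set.Icc (-A) A →
          HasSum (fun i => Literature.NumberTheory.LFunctions.weilMellin g (1 / 2 + (γ i : ℂ) * Complex.I))
            (Literature.NumberTheory.LFunctions.weilFunctional g) := by
  intro A hA ι γ h g hg hgs
  -- `γ` is a window-trace family at level `A/2`; the family sum converges for every test
  have hA2 : 0 < A / 2 := half_pos hA
  have h2 := h (A / 2) hA2 (half_lt_self hA)
  have hsum : Summable fun i => weilMellin g (1 / 2 + (γ i : ℂ) * I) :=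
    summable_weilMellin_of_windowTrace hA2 h2 hg
  suffices heq : ∑' i, weilMellin g (1 / 2 + (γ i : ℂ) * I) = weilFunctional g by
    rw [← heq]
    exact hsum.hasSum
  -- (1) the identity for the dilates `g(c ·)`, `c > 1`
  have hid : ∀ c : ℝ, 1 < c →
      ∑' i, weilMellin (fun t => g (c * t)) (1 / 2 + (γ i : ℂ) * I) =
        weilFunctional (fun t => g (c * t)) := by
    intro c hc
    have hc0 : 0 < c := one_pos.trans hc
    exact (h (A / c) (div_pos hA hc0) (div_lt_self hA hc) (fun t => g (c * t))
      (hg.comp_mul hc0.ne') (tsupport_comp_mul_subset g hc0 hgs)).tsum_eq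
  -- (2) `W(g(c ·)) → W(g)` as `c → 1⁺`
  have hW : Tendsto (fun c : ℝ => weilFunctional (fun t => g (c * t))) (𝓝[>] 1)
      (𝓝 (weilFunctional g)) := by
    have := (hasDerivAt_weilFunctional_comp_mul hg one_pos).continuousAt.tendsto
    simp only [one_mul] at this
    exact tendsto_nhdsWithin_of_tendsto_nhds this
  -- (3) `Σ_i ĝ_c(1/2 + iγ_i) → Σ_i ĝ(1/2 + iγ_i)` as `c → 1⁺` (Tannery)
  have hbound : Summable fun i =>
      16 * (weilDecayConst g + weilDecayConst (deriv (deriv g))) / (1 + γ i ^ 2) ^ 2 :=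
    ((summable_one_div_one_add_sq_sq_of_windowTrace hA2 h2).mul_left
      (16 * (weilDecayConst g + weilDecayConst (deriv (deriv g))))).congr
      fun i => by rw [mul_one_div]
  have hT : Tendsto (fun c : ℝ => ∑' i, weilMellin (fun t => g (c * t)) (1 / 2 + (γ i : ℂ) * I))
      (𝓝[>] 1) (𝓝 (∑' i, weilMellin g (1 / 2 + (γ i : ℂ) * I))) := by
    refine tendsto_tsum_of_dominated_convergence
      (f := fun (c : ℝ) i => weilMellin (fun t => g (c * t)) (1 / 2 + (γ i : ℂ) * I))
      hbound (fun i => ?_) ?_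
    · have := (hasDerivAt_weilMellin_comp_mul hg one_pos
        (1 / 2 + (γ i : ℂ) * I)).continuousAt.tendsto
      simp only [one_mul] at this
      exact tendsto_nhdsWithin_of_tendsto_nhds this
    · filter_upwards [Ioo_mem_nhdsGT (one_lt_two : (1 : ℝ) < 2)] with c hc i
      exact norm_weilMellin_comp_mul_le hg hc.1.le hc.2.le (γ i)
  -- (4) uniqueness of limits along `𝓝[>] 1`
  have hEq : (fun c : ℝ => ∑' i, weilMellin (fun t => g (c * t)) (1 / 2 + (γ i : ℂ) * I))
      =ᶠ[𝓝[>] 1] fun c => weilFunctional (fun t => g (c * t)) := by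
    filter_upwards [self_mem_nhdsWithin] with c hc
    exact hid c hc
  exact tendsto_nhds_unique_of_eventuallyEq hT hW hEq

end Summit.RiemannHypothesis.RiemannHypothesis.Theorems.SpectralTraceWindowStep

end
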